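import Summits.ABC.ABC.Theorems.IsogenyGlueCongruenceMazurKenkuBoundOfEightTables
import Literature.NumberTheory.EllipticCurves.KenkuMinimalLevelsKleinFrickeFiveSeven
import HarnessLib

/-!
# Route `IsogenyGlueCongruence`, crux `KenkuPrintedLevels` (stmt-ABC-18224), conjunct (ii), level `35`:
# REDUCTION of "no cyclic rational `35`-isogeny" to the Klein–Fricke `5 × 7` fibre product

`Summits/ABC/ABC/Theorems/IsogenyGlueCongruenceKenkuPrintedLevelsLevelThirtyFive.lean` — unit
`abc-inputs-pr-1` (KEY A1L-SWEEP parcel 2, INPUTS-LIST row I-07; progress on the open residue of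
Kenku's theorem, not closure). PROOFS ONLY (0 definitions, 0 named facts).

Level `35 = 5 · 7` is one of the five levels of conjunct (ii) of `KenkuPrintedLevels`
(`Y₀(N)(ℚ) = ∅` for `N ∈ {26, 35, 65, 125, 169}`; `X₀(35)` has genus `3`, `Y₀(35)(ℚ) = ∅` is due to
Kubert / Kenku, [cite: Kenku1982, Thm. 1 and its proof, pp. 199–201]). The tree proves the
Klein–Fricke theorems at `5` and `7` over any field of characteristic `0`
(`Isogeny.exists_j_eq_klein_five_of_five_dvd_degree`: a cyclic isogeny of degree divisible by `5`
forces `j = (H² + 10H + 5)³/H`, `H ≠ 0`; `Isogeny.exists_j_eq_klein_seven_of_seven_dvd_degree`: degree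
divisible by `7` and `j ≠ 0` force `j = (t² + 13t + 49)(t² + 5t + 1)³/t`, `t ≠ 0`), exactly as it
did for the genus-one levels `15 = 3·5`, `21 = 3·7` (`levelFifteen_jTable`, `levelTwentyOne_jTable_of`).
Hence (this file):

* `exists_kleinFive_kleinSeven_of_isCyclic_degree_thirtyFive` — a cyclic rational `35`-isogeny out of
  `V` produces a rational point `(H, t)`, `H t ≠ 0`, of the fibre product
  `X₀(5) ×_{X(1)} X₀(7)` (birational to `X₀(35)`):
  `(H² + 10H + 5)³ · t = (t² + 13t + 49)(t² + 5t + 1)³ · H`, both sides equal to `j(V) · H · t`,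
  with `j(V) ∉ {0, 1728}` (`klein_five_j_ne_zero_and_ne_1728`);
* `isCyclic_degree_ne_thirtyFive_of_fibreProduct` — **level `35` of conjunct (ii) REDUCED to the
  explicit Diophantine statement** `D₃₅`: the affine curve above has no rational point with `H t ≠ 0`;
* `fibreProduct_thirtyFive_integral_of_rational` — the integral normalisation of `D₃₅` a descent would
  start from (rational-root theorem, `klein_five_integrality` / `klein_seven_integrality`): writing
  `j = n/d`, `u = dH` and `u' = dt` are nonzero integers with `u ∣ 125 d⁶`, `u' ∣ 49 d⁸`,
  `(u² + 10du + 5d²)³ = d⁴ n u`, `(u'² + 13du' + 49d²)(u'² + 5du' + d²)³ = d⁶ n u'`; so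
  `isCyclic_degree_ne_thirtyFive_of_integral`.

WHAT IS NOT HERE (the open part, stated for the next seat). `D₃₅` itself = the rational points of the
genus-`3` curve `X₀(35)` are its four cusps. The printed proofs go through the Jacobian: `J₀(35) ∼ E × A`
with `E` of conductor `35` (Cremona `35a`, `E(ℚ) ≅ ℤ/3`, no rational `2`-torsion) — the analogue of the
tree's `Curve15A1.finite_point` / `Curve21A1.finite_point` (complete `2`-descents) would here be a
`3`-isogeny descent on `35a` (Vélu's `3`-isogeny is in the tree, `ThreeIsogeny.lean`; the Selmer side is
not), plus an explicit degree-`2` map `X₀(35) → X₀(35)/w` onto that curve in the coordinates `(H, t)`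
(the analogue of `XZeroFifteen.exists_point`, `XZeroTwentyOne.exists_point_rat`). Neither is attempted
in this file. Nothing here is conditional on a named fact; no summit, rung or item is proved; abc moved
by 0.
-/

-- `Summit.ABC.ABC` is the mandated summit-side namespace (CONVENTIONS §2); the duplicate is deliberate.
set_option linter.dupNamespace false

noncomputable section
open WeierstrassCurve
open Literature.NumberTheory.EllipticCurves

namespace Summit.ABC.ABC.Theorems

/-! ### A cyclic `35`-isogeny gives a rational point of the `5 × 7` fibre product -/

/-- **A cyclic rational `35`-isogeny gives a non-cuspidal rational point of `X₀(5) ×_{X(1)} X₀(7)`.**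
If `ψ : V → V'` is a cyclic `ℚ`-isogeny of degree `35`, there are `H, t ∈ ℚˣ` with
`j(V) = (H² + 10H + 5)³/H = (t² + 13t + 49)(t² + 5t + 1)³/t`; in particular `j(V) ≠ 0, 1728` and
`(H² + 10H + 5)³ · t = (t² + 13t + 49)(t² + 5t + 1)³ · H`. Klein–Fricke at `5` on the cyclic
degree-`5` quotient, then (as `j ≠ 0`) Klein–Fricke at `7` on the cyclic degree-`7` quotient.
[cite: Kenku1982, proof of Thm. 1, p. 201] [cite: SilvermanAEC2009, III.4.12] -/
theorem exists_kleinFive_kleinSeven_of_isCyclic_degree_thirtyFive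
    (V V' : WeierstrassCurve ℚ) [V.IsElliptic] [V'.IsElliptic] (ψ : Isogeny V V')
    (hψ : ψ.IsCyclic) (hdeg : ψ.degree = 35) :
    ∃ H t : ℚ, H ≠ 0 ∧ t ≠ 0 ∧ V.j ≠ 0 ∧ V.j ≠ 1728 ∧
      V.j = (H ^ 2 + 10 * H + 5) ^ 3 / H ∧
      V.j = (t ^ 2 + 13 * t + 49) * (t ^ 2 + 5 * t + 1) ^ 3 / t ∧
      (H ^ 2 + 10 * H + 5) ^ 3 * t = (t ^ 2 + 13 * t + 49) * (t ^ 2 + 5 * t + 1) ^ 3 * H := by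
  obtain ⟨H, hH0, hjH⟩ :=
    ψ.exists_j_eq_klein_five_of_five_dvd_degree hψ (hdeg ▸ (by norm_num : (5 : ℕ) ∣ 35))
  have hjH' : V.j * H = (H ^ 2 + 10 * H + 5) ^ 3 := by
    rw [hjH]; field_simp
  obtain ⟨hj0, hj1728⟩ := klein_five_j_ne_zero_and_ne_1728 hjH'
  obtain ⟨t, ht0, hjt⟩ :=
    ψ.exists_j_eq_klein_seven_of_seven_dvd_degree hψ (hdeg ▸ (by norm_num : (7 : ℕ) ∣ 35)) hj0
  have hjt' : V.j * t = (t ^ 2 + 13 * t + 49) * (t ^ 2 + 5 * t + 1) ^ 3 := by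
    rw [hjt]; field_simp
  refine ⟨H, t, hH0, ht0, hj0, hj1728, hjH, hjt, ?_⟩
  linear_combination H * hjt' - t * hjH'

/-! ### Level `35` reduced to the Diophantine statement `D₃₅` -/

/-- **Level `35` of `KenkuPrintedLevels` (ii), reduced to the fibre product.** If the affine curve
`(H² + 10H + 5)³ · t = (t² + 13t + 49)(t² + 5t + 1)³ · H` has no rational point with `H t ≠ 0`
(`D₃₅`: the rational points of `X₀(35)` are cusps — Kubert / Kenku; NOT proved here, taken as the
displayed hypothesis `hD`), then no elliptic curve over `ℚ` admits a cyclic `ℚ`-isogeny of degree `35`.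
[cite: Kenku1982, Thm. 1 and its proof, pp. 199–201] -/
theorem isCyclic_degree_ne_thirtyFive_of_fibreProduct
    (hD : ∀ H t : ℚ, H ≠ 0 → t ≠ 0 →
      (H ^ 2 + 10 * H + 5) ^ 3 * t ≠ (t ^ 2 + 13 * t + 49) * (t ^ 2 + 5 * t + 1) ^ 3 * H)
    (V V' : WeierstrassCurve ℚ) [V.IsElliptic] [V'.IsElliptic] (ψ : Isogeny V V')
    (hψ : ψ.IsCyclic) : ψ.degree ≠ 35 := fun hdeg ↦ by
  obtain ⟨H, t, hH0, ht0, -, -, -, -, hrel⟩ :=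
    exists_kleinFive_kleinSeven_of_isCyclic_degree_thirtyFive V V' ψ hψ hdeg
  exact hD H t hH0 ht0 hrel

/-- The same reduction with the fibre product restricted to points over `j ∉ {0, 1728}` and written
through the common value `j`: it suffices that no `j ∈ ℚ ∖ {0, 1728}` is simultaneously of the form
`(H² + 10H + 5)³/H` and `(t² + 13t + 49)(t² + 5t + 1)³/t` with `H, t ∈ ℚˣ`.
[cite: Kenku1982, Thm. 1 and its proof, pp. 199–201] -/
theorem isCyclic_degree_ne_thirtyFive_of_no_common_j
    (hD : ∀ j H t : ℚ, j ≠ 0 → j ≠ 1728 → H ≠ 0 → t ≠ 0 →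
      j = (H ^ 2 + 10 * H + 5) ^ 3 / H → j ≠ (t ^ 2 + 13 * t + 49) * (t ^ 2 + 5 * t + 1) ^ 3 / t)
    (V V' : WeierstrassCurve ℚ) [V.IsElliptic] [V'.IsElliptic] (ψ : Isogeny V V')
    (hψ : ψ.IsCyclic) : ψ.degree ≠ 35 := fun hdeg ↦ by
  obtain ⟨H, t, hH0, ht0, hj0, hj1728, hjH, hjt, -⟩ :=
    exists_kleinFive_kleinSeven_of_isCyclic_degree_thirtyFive V V' ψ hψ hdeg
  exact hD V.j H t hj0 hj1728 hH0 ht0 hjH hjt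

/-! ### The integral normalisation of `D₃₅` -/

/-- **Integral form of a rational point of the `5 × 7` fibre product.** If `H, t ∈ ℚˣ` satisfy
`(H² + 10H + 5)³/H = (t² + 13t + 49)(t² + 5t + 1)³/t` `(= j)`, then writing `j = n/d` (`d = den j`,
`n = num j`) the numbers `u = dH`, `u' = dt` are nonzero INTEGERS with `u ∣ 125 d⁶`, `u' ∣ 49 d⁸`,
`(u² + 10du + 5d²)³ = d⁴ n u` and `(u'² + 13du' + 49d²)(u'² + 5du' + d²)³ = d⁶ n u'` (rational-root
theorem on the two Klein–Fricke relations, `klein_five_integrality`, `klein_seven_integrality`).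
[folklore] -/
theorem fibreProduct_thirtyFive_integral_of_rational {H t : ℚ} (hH0 : H ≠ 0) (ht0 : t ≠ 0)
    (h : (H ^ 2 + 10 * H + 5) ^ 3 / H = (t ^ 2 + 13 * t + 49) * (t ^ 2 + 5 * t + 1) ^ 3 / t) :
    ∃ n d u u' : ℤ, d ≠ 0 ∧ u ≠ 0 ∧ u' ≠ 0 ∧ u ∣ 125 * d ^ 6 ∧ u' ∣ 49 * d ^ 8 ∧
      (u ^ 2 + 10 * d * u + 5 * d ^ 2) ^ 3 = d ^ 4 * n * u ∧
      (u' ^ 2 + 13 * d * u' + 49 * d ^ 2) * (u' ^ 2 + 5 * d * u' + d ^ 2) ^ 3 = d ^ 6 * n * u' := by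
  obtain ⟨j, hj⟩ : ∃ j : ℚ, j = (H ^ 2 + 10 * H + 5) ^ 3 / H := ⟨_, rfl⟩
  have hd : (j.den : ℤ) ≠ 0 := by exact_mod_cast j.den_nz
  have hnd : j = (j.num : ℚ) / ((j.den : ℤ) : ℚ) := by
    push_cast; exact (Rat.num_div_den j).symm
  have h5 : (H ^ 2 + 10 * H + 5) ^ 3 / H = (j.num : ℚ) / ((j.den : ℤ) : ℚ) := by rw [← hnd, hj]
  have h7 : (t ^ 2 + 13 * t + 49) * (t ^ 2 + 5 * t + 1) ^ 3 / t = (j.num : ℚ) / ((j.den : ℤ) : ℚ) := by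
    rw [← h]; exact h5
  obtain ⟨u, hu0, hudvd, hu⟩ := klein_five_integrality hH0 hd h5
  obtain ⟨u', hu'0, hu'dvd, hu'⟩ := klein_seven_integrality ht0 hd h7
  exact ⟨j.num, j.den, u, u', hd, hu0, hu'0, hudvd, hu'dvd, hu, hu'⟩

/-- **Level `35` reduced to an integral Diophantine statement**: if no integers `n, d, u, u'` with
`d, u, u' ≠ 0`, `u ∣ 125 d⁶`, `u' ∣ 49 d⁸` satisfy `(u² + 10du + 5d²)³ = d⁴ n u` and
`(u'² + 13du' + 49d²)(u'² + 5du' + d²)³ = d⁶ n u'`, then there is no cyclic rational `35`-isogeny.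
[cite: Kenku1982, Thm. 1 and its proof, pp. 199–201] -/
theorem isCyclic_degree_ne_thirtyFive_of_integral
    (hD : ∀ n d u u' : ℤ, d ≠ 0 → u ≠ 0 → u' ≠ 0 → u ∣ 125 * d ^ 6 → u' ∣ 49 * d ^ 8 →
      (u ^ 2 + 10 * d * u + 5 * d ^ 2) ^ 3 = d ^ 4 * n * u →
      (u' ^ 2 + 13 * d * u' + 49 * d ^ 2) * (u' ^ 2 + 5 * d * u' + d ^ 2) ^ 3 ≠ d ^ 6 * n * u')
    (V V' : WeierstrassCurve ℚ) [V.IsElliptic] [V'.IsElliptic] (ψ : Isogeny V V')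
    (hψ : ψ.IsCyclic) : ψ.degree ≠ 35 := fun hdeg ↦ by
  obtain ⟨H, t, hH0, ht0, -, -, hjH, hjt, -⟩ :=
    exists_kleinFive_kleinSeven_of_isCyclic_degree_thirtyFive V V' ψ hψ hdeg
  obtain ⟨n, d, u, u', hd, hu0, hu'0, hudvd, hu'dvd, hu, hu'⟩ :=
    fibreProduct_thirtyFive_integral_of_rational hH0 ht0 (hjH.symm.trans hjt)
  exact hD n d u u' hd hu0 hu'0 hudvd hu'dvd hu hu'

end Summit.ABC.ABC.Theorems

end
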